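/-
Copyright (c) 2026. All rights reserved.
Released under Apache 2.0 license as described in the file LICENSE.
Authors: abc-iut cell — seat abc-iut-w4-d104 (gen 3): row «COR29-GENUINE-INSTANTIATE» (L4-lead 10:30:22Z) —
[AbsTopIII] Cor 2.9 for `D : NFCurveData` at the GENUINE NF-point predicate and the GENUINE extended values.
-/
import Literature.AnabelianGeometry.AbsoluteAnabelian.ArchimedeanReconstructionCor29Globalise
import HarnessLib

/-!
# [AbsTopIII] Cor 2.9 for `D : NFCurveData` at the genuine NF-points and the genuine extended evaluation

S. Mochizuki, *Topics in absolute anabelian geometry III* (bib key `MochizukiAbsTopIII2015`), Cor 2.8 (a)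
p.63 and Cor 2.9 pp.64–65.  PROOF-ONLY sequel of `ArchimedeanReconstructionCor29Globalise.lean`
(`NFCurveData.cor29Refined_of_chartPackage`, p436603), which left the NF-point predicate `isNFPoint` and the
values `fval` FREE (reading-1 vacuity at `isNFPoint := ⊥`, finding of abc-iut-f-075).  Here both are the
GENUINE data of the interface, written as explicit terms (no definitions):

* **`isNFPoint x`** := `x ∈ X^top` is the class of a Cauchy sequence of NF-points `{x_j}` CONVERGING TO an
  NF-point `P` — `f(x_j) → f(P)` in `k_v` for every NF-rational `f` regular at `P`.  (Print p.63 (a): a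
  conductor `S` has `x_j ∉ S` for almost all `j` and governs the `f` whose poles avoid `S`; the NF-point `P`
  enters `X^top = X_v(k_v)` as the class of the sequences converging to it — constant sequences are not
  Cauchy sequences of the formalism when some `f` has a pole at `P` — so «image of `D.Pt`» is read through
  limits.  Whether such sequences EXIST is the density input `AnalyticComparison.PointsAreLimits` of the
  Cor 2.8 sub-DAG, not assumed here: at a datum without them the statement is vacuous, honestly.)
* **`fval f x`** := `limUnder atTop (j ↦ f(x_j))` along the representative `Quot.out x` — "the function
  defined by `f` on `U_X` [i.e., by taking limits of Cauchy sequences of values in `k_v`]" (p.63 (b)); junk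
  where the values do not converge; **`vanishesAt f x`** := `fval f x = 0`.

* `NFCurveData.cor29Refined_genuine` — the refined rows `Cor29Refined` for these data under the ONE named
  hypothesis `hG` (chart package at the genuine NF-points, chart expressions of the genuine `fval`, a
  uniformiser, `κ : ℂ ≃ k_v`), and `NFCurveData.globalArchimedeanCompatibility_genuine` — the statement of
  record.

CAVEAT (L): Cor 2.9's `L` is the Cor 2.7 (e) local linear holomorphic structure OF the Aut-holomorphic space
`𝕏_v` of Cor 2.8; its construction from `Aut^hol` alone is row «COR27e-TYPE» (abc-iut-w6-d024, being typed).
Until it lands, `L` here is the chart-centred pull-back `planeStructure.comap (fun _ ↦ 0)` of p436603 —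
TODO(successor): `L :=` the Cor 2.7 (e) structure of `𝕏_v`, scalar isomorphisms re-pinned.  HONEST SCOPE:
hypothesis named, not discharged; refereed pre-IUT material; nothing here bears on the disputed [IUTchIII]
Cor. 3.12; typed ≠ endorsed.
-/

noncomputable section

namespace Literature.AnabelianGeometry.AbsoluteAnabelian

open _root_.Set _root_.Topology _root_.Filter _root_.Metric _root_.Function

namespace ArchimedeanReconstruction

open Cor29

/-- **The genuine extended evaluation agrees with the Cor 2.8 (b) charts**: on a charted open `U_X` with
chart `f_U` defined by the NF-rational function `f`, the value `fval f x = lim_j f(x_j)` along any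
representative of `x ∈ U_X` IS `f_U(x)` ("the function defined by `f` on `U_X` [i.e., by taking limits of
Cauchy sequences of values in `k_v`]", p.63 (b)). [cite: MochizukiAbsTopIII2015, Corollary 2.8 (b) p.63] -/
theorem NFCurveData.Chart.limUnder_valv_eq (D : NFCurveData) {UX : TopologicalSpace.Opens D.Xtop}
    (c : D.Chart UX) (x : D.Xtop) (hx : x ∈ UX) :
    limUnder atTop (fun j => D.valv c.f ((Quot.out x).1 j)) = ((c.fU ⟨x, hx⟩ : c.Uv) : D.kv) := by
  have hq : Quot.mk _ (Quot.out x) = x := Quot.out_eq x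
  have hx' : Quot.mk _ (Quot.out x) ∈ UX := by rw [hq]; exact hx
  have h := c.fU_spec (Quot.out x) hx'
  have heq : (⟨Quot.mk _ (Quot.out x), hx'⟩ : UX) = ⟨x, hx⟩ := Subtype.ext hq
  rw [heq] at h
  exact h.limUnder_eq

open Classical in
/-- **[AbsTopIII] Cor 2.9, refined rows, for `D : NFCurveData` at the GENUINE NF-point predicate and the
GENUINE extended evaluation** (see the module docstring for the two terms), under the chart-package
hypothesis `hG`/`hspan` at those points and values and `κ : ℂ ≃ k_v`.
[cite: MochizukiAbsTopIII2015, Corollary 2.9 pp.64–65] -/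
theorem NFCurveData.cor29Refined_genuine (D : NFCurveData)
    (W : D.Xtop → Set D.Xtop) (e : D.Xtop → D.Xtop → ℂ) (e' : D.Xtop → ℂ → D.Xtop) (r : D.Xtop → ℝ)
    (G : D.Xtop → D.Fn → ℂ → ℂ) (κ : ℂ ≃+* D.kv) (hκ : Continuous κ) (hκ' : Continuous κ.symm)
    (hpkg : ∀ x : D.Xtop,
      (∃ (P : D.Pt) (s : {x : ℕ → D.Pt // D.IsCauchy x}), Quot.mk _ s = x ∧
        ∀ f : D.Fn, D.eval f P ≠ none → Tendsto (fun j => D.valv f (s.1 j)) atTop (𝓝 (D.valv f P))) →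
      0 < r x ∧ IsOpen (W x) ∧ x ∈ W x ∧ ContinuousOn (e x) (W x) ∧
        MapsTo (e x) (W x) (ball (e x x) (r x)) ∧ ContinuousOn (e' x) (ball (e x x) (r x)) ∧
        MapsTo (e' x) (ball (e x x) (r x)) (W x) ∧ (∀ v ∈ W x, e' x (e x v) = v) ∧
        ∀ w ∈ ball (e x x) (r x), e x (e' x w) = w)
    (hG : ∀ x : D.Xtop,
      (∃ (P : D.Pt) (s : {x : ℕ → D.Pt // D.IsCauchy x}), Quot.mk _ s = x ∧
        ∀ f : D.Fn, D.eval f P ≠ none → Tendsto (fun j => D.valv f (s.1 j)) atTop (𝓝 (D.valv f P))) →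
      ∀ f : D.Fn, limUnder atTop (fun j => D.valv f ((Quot.out x).1 j)) = 0 →
        DifferentiableAt ℂ (G x f) (e x x) ∧
          ∀ᶠ u in 𝓝 x, κ.symm (limUnder atTop (fun j => D.valv f ((Quot.out u).1 j))) = G x f (e x u))
    (hspan : ∀ x : D.Xtop,
      (∃ (P : D.Pt) (s : {x : ℕ → D.Pt // D.IsCauchy x}), Quot.mk _ s = x ∧
        ∀ f : D.Fn, D.eval f P ≠ none → Tendsto (fun j => D.valv f (s.1 j)) atTop (𝓝 (D.valv f P))) →
      ∃ f : D.Fn, limUnder atTop (fun j => D.valv f ((Quot.out x).1 j)) = 0 ∧ deriv (G x f) (e x x) ≠ 0) :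
    D.Cor29Refined (Cor29Model.planeStructure.comap (fun _ : D.Xtop => (0 : ℂ)))
      (fun x => ∃ (P : D.Pt) (s : {x : ℕ → D.Pt // D.IsCauchy x}), Quot.mk _ s = x ∧
        ∀ f : D.Fn, D.eval f P ≠ none → Tendsto (fun j => D.valv f (s.1 j)) atTop (𝓝 (D.valv f P)))
      (fun _ => D.kv) (fun x f => κ (deriv (G x f) (e x x)))
      (fun f x => limUnder atTop (fun j => D.valv f ((Quot.out x).1 j)) = 0)
      (fun x a b => e' x (e x a + e x b - e x x))
      (fun x n v => if v ∈ W x ∧ ‖e x v - e x x‖ < r x / 2 then e' x (e x x + (e x v - e x x) / (n : ℂ)) else x)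
      (fun f x => limUnder atTop (fun j => D.valv f ((Quot.out x).1 j)))
      (fun x u v => e' x (e x x +
        (((Cor29Model.mult 0 : (Cor29Model.planeStructure.comap (fun _ : D.Xtop => (0 : ℂ))).A x ≃ₜ* ℂˣ) u :
          ℂˣ) : ℂ) * (e x v - e x x))) :=
  D.cor29Refined_of_chartPackage _ W e e' r (fun x hx => (hpkg x hx).1)
    (fun x hx => ⟨(hpkg x hx).2.1, (hpkg x hx).2.2.1⟩)
    (fun x hx => ⟨(hpkg x hx).2.2.2.1, (hpkg x hx).2.2.2.2.1⟩)
    (fun x hx => ⟨(hpkg x hx).2.2.2.2.2.1, (hpkg x hx).2.2.2.2.2.2.1⟩)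
    (fun x hx => (hpkg x hx).2.2.2.2.2.2.2.1) (fun x hx => (hpkg x hx).2.2.2.2.2.2.2.2)
    _ _ G κ hκ hκ' (fun x hx f hf => ⟨(hG x hx f hf).1, (hG x hx f hf).2, hf⟩) (fun _ _ h => h) hspan

open Classical in
/-- **[AbsTopIII] Cor 2.9 — the statement of record for `D : NFCurveData` at the genuine NF-points and the
genuine extended evaluation**, under the chart-package hypothesis (caveat on `L` in the module docstring).
[cite: MochizukiAbsTopIII2015, Corollary 2.9 pp.64–65] -/
theorem NFCurveData.globalArchimedeanCompatibility_genuine (D : NFCurveData)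
    (W : D.Xtop → Set D.Xtop) (e : D.Xtop → D.Xtop → ℂ) (e' : D.Xtop → ℂ → D.Xtop) (r : D.Xtop → ℝ)
    (G : D.Xtop → D.Fn → ℂ → ℂ) (κ : ℂ ≃+* D.kv) (hκ : Continuous κ) (hκ' : Continuous κ.symm)
    (hpkg : ∀ x : D.Xtop,
      (∃ (P : D.Pt) (s : {x : ℕ → D.Pt // D.IsCauchy x}), Quot.mk _ s = x ∧
        ∀ f : D.Fn, D.eval f P ≠ none → Tendsto (fun j => D.valv f (s.1 j)) atTop (𝓝 (D.valv f P))) →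
      0 < r x ∧ IsOpen (W x) ∧ x ∈ W x ∧ ContinuousOn (e x) (W x) ∧
        MapsTo (e x) (W x) (ball (e x x) (r x)) ∧ ContinuousOn (e' x) (ball (e x x) (r x)) ∧
        MapsTo (e' x) (ball (e x x) (r x)) (W x) ∧ (∀ v ∈ W x, e' x (e x v) = v) ∧
        ∀ w ∈ ball (e x x) (r x), e x (e' x w) = w)
    (hG : ∀ x : D.Xtop,
      (∃ (P : D.Pt) (s : {x : ℕ → D.Pt // D.IsCauchy x}), Quot.mk _ s = x ∧
        ∀ f : D.Fn, D.eval f P ≠ none → Tendsto (fun j => D.valv f (s.1 j)) atTop (𝓝 (D.valv f P))) →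
      ∀ f : D.Fn, limUnder atTop (fun j => D.valv f ((Quot.out x).1 j)) = 0 →
        DifferentiableAt ℂ (G x f) (e x x) ∧
          ∀ᶠ u in 𝓝 x, κ.symm (limUnder atTop (fun j => D.valv f ((Quot.out u).1 j))) = G x f (e x u))
    (hspan : ∀ x : D.Xtop,
      (∃ (P : D.Pt) (s : {x : ℕ → D.Pt // D.IsCauchy x}), Quot.mk _ s = x ∧
        ∀ f : D.Fn, D.eval f P ≠ none → Tendsto (fun j => D.valv f (s.1 j)) atTop (𝓝 (D.valv f P))) →
      ∃ f : D.Fn, limUnder atTop (fun j => D.valv f ((Quot.out x).1 j)) = 0 ∧ deriv (G x f) (e x x) ≠ 0) :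
    GlobalArchimedeanCompatibility D (Cor29Model.planeStructure.comap (fun _ : D.Xtop => (0 : ℂ)))
      (fun x => ∃ (P : D.Pt) (s : {x : ℕ → D.Pt // D.IsCauchy x}), Quot.mk _ s = x ∧
        ∀ f : D.Fn, D.eval f P ≠ none → Tendsto (fun j => D.valv f (s.1 j)) atTop (𝓝 (D.valv f P)))
      (fun _ => D.kv) (fun x f => κ (deriv (G x f) (e x x)))
      (fun f x => limUnder atTop (fun j => D.valv f ((Quot.out x).1 j)) = 0)
      (fun x n v => if v ∈ W x ∧ ‖e x v - e x x‖ < r x / 2 then e' x (e x x + (e x v - e x x) / (n : ℂ)) else x)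
      (fun f x => limUnder atTop (fun j => D.valv f ((Quot.out x).1 j))) :=
  D.globalArchimedeanCompatibility_of_refined _ _ _ _ _ _ _ _ _
    (D.cor29Refined_genuine W e e' r G κ hκ hκ' hpkg hG hspan)

end ArchimedeanReconstruction

end Literature.AnabelianGeometry.AbsoluteAnabelian

end
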